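import Literature.Analysis.ODE.RegularLevelCurves
import Mathlib.Analysis.Calculus.ImplicitContDiff
import Mathlib.Analysis.Calculus.Deriv.Slope
import Mathlib.Analysis.Calculus.Deriv.Pi
import HarnessLib

/-!
# Regular level curves II: the flow box and properness of injective trajectories

Topic `Literature/Analysis/ODE`, sequel to `RegularLevelCurves.lean` (a `C¹` map
`H : ℝ^{d+1} → ℝ^d` with a tangent field `v`, `Γ = H⁻¹(0)` regular, global trajectories
`LevelCurveData.traj` of the renormalised field). Here the hypothesis that `dH` is onto along `Γ`
is put to work (A. G. Khovanskii, *Fewnomials* (1991), Ch. III: the phase curves of the field are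
the components of `Γ`; J. Milnor, *Topology from the Differentiable Viewpoint* (1965), §2 and
Appendix "Classification of one-manifolds"). Everything is **proved**:

* `LevelCurveData.ker_fderiv_eq_span` — on `Γ`, `ker dH_z = ℝ v(z)` (rank–nullity);
* `LevelCurveData.implicitData` — the implicit-function data (`ImplicitFunctionData`) at
  `z₀ ∈ Γ`: `H` together with a coordinate `x_{j₀}` with `v(z₀)_{j₀} ≠ 0`;
* `LevelCurveData.exists_nhds_curve_inter_subset_traj` — **flow box**: every `z₀ ∈ Γ` has a
  neighbourhood `U` with `Γ ∩ U ⊆ traj z₀ '' (-1, 1)` (implicit function theorem: near `z₀`, `Γ`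
  is a graph over `x_{j₀}`; along the trajectory through `z₀` this coordinate has nonzero
  derivative, hence passes strictly through `z₀^{j₀}`, and the intermediate value theorem matches
  every nearby point of `Γ` with a trajectory point);
* `LevelCurveData.exists_abs_le_of_injective`, `tendsto_norm_traj_atTop`, `tendsto_norm_traj_atBot`
  — **properness**: an injective trajectory in `Γ` leaves every bounded set in both time
  directions (a limit point of `γ(tₖ)`, `|tₖ| → ∞`, would by the flow box and uniqueness sit at
  time distance `< 1` from infinitely many `tₖ`).

## References

* A. G. Khovanskii, *Fewnomials*, Transl. Math. Monogr. 88, AMS (1991), Ch. III.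
* J. Milnor, *Topology from the Differentiable Viewpoint* (1965), §2, Appendix. [MilnorTDV1965]
-/

noncomputable section

open Set Metric Filter Function
open scoped Topology NNReal

namespace Literature.Analysis.ODE

/-! ### The flow box: near a point of `Γ`, the curve is an arc of one trajectory -/

namespace LevelCurveData

variable {d : ℕ} (D : LevelCurveData d)

/-- On `Γ`, the kernel of `dH_z` is the line spanned by `v(z)` (rank–nullity). [folklore] -/
theorem ker_fderiv_eq_span {z : Fin (d + 1) → ℝ} (hz : z ∈ D.curve) :
    (fderiv ℝ D.H z).ker = Submodule.span ℝ {D.v z} := by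
  set f : (Fin (d + 1) → ℝ) →ₗ[ℝ] (Fin d → ℝ) := (fderiv ℝ D.H z).toLinearMap with hf
  change LinearMap.ker f = _
  have hrange : LinearMap.range f = ⊤ := LinearMap.range_eq_top.2 (D.surjective_fderiv hz)
  have h1 := LinearMap.finrank_range_add_finrank_ker f
  rw [hrange, finrank_top, Module.finrank_fin_fun, Module.finrank_fin_fun] at h1
  have hker : Module.finrank ℝ (LinearMap.ker f) = 1 := by omega
  have hle : Submodule.span ℝ {D.v z} ≤ LinearMap.ker f := by
    rw [Submodule.span_le, Set.singleton_subset_iff, SetLike.mem_coe, LinearMap.mem_ker, hf,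
      ContinuousLinearMap.coe_coe]
    exact D.fderiv_H_v z
  have hspan : Module.finrank ℝ (Submodule.span ℝ {D.v z}) = 1 :=
    finrank_span_singleton (D.v_ne_zero hz)
  exact (Submodule.eq_of_le_of_finrank_eq hle (hspan.trans hker.symm)).symm

/-- A tangent vector to `Γ` at `z` (an element of `ker dH_z`) is a multiple of `v(z)`. [folklore] -/
theorem exists_smul_of_fderiv_eq_zero {z : Fin (d + 1) → ℝ} (hz : z ∈ D.curve)
    {x : Fin (d + 1) → ℝ} (hx : fderiv ℝ D.H z x = 0) : ∃ c : ℝ, c • D.v z = x := by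
  have hx' : x ∈ (fderiv ℝ D.H z).ker := by
    rw [LinearMap.mem_ker, ContinuousLinearMap.coe_coe]
    exact hx
  rw [D.ker_fderiv_eq_span hz, Submodule.mem_span_singleton] at hx'
  exact hx'

/-- The implicit-function data at a point `z₀ ∈ Γ`: `H` together with the coordinate `x ↦ x j₀`
for an index `j₀` with `v(z₀)_{j₀} ≠ 0` (the kernel line `ℝ v(z₀)` of `dH` is complementary to the
hyperplane `x_{j₀} = 0`). [folklore] -/
def implicitData {z₀ : Fin (d + 1) → ℝ} (hz₀ : z₀ ∈ D.curve) {j₀ : Fin (d + 1)}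
    (hj₀ : D.v z₀ j₀ ≠ 0) :
    ImplicitFunctionData ℝ (Fin (d + 1) → ℝ) (Fin d → ℝ) ℝ where
  leftFun := D.H
  leftDeriv := fderiv ℝ D.H z₀
  rightFun := fun x => x j₀
  rightDeriv := ContinuousLinearMap.proj j₀
  pt := z₀
  hasStrictFDerivAt_leftFun := D.contDiff_H.contDiffAt.hasStrictFDerivAt one_ne_zero
  hasStrictFDerivAt_rightFun := hasStrictFDerivAt_apply j₀ z₀
  range_leftDeriv := LinearMap.range_eq_top.2 (D.surjective_fderiv hz₀)
  range_rightDeriv := by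
    refine LinearMap.range_eq_top.2 fun r => ⟨Pi.single j₀ r, ?_⟩
    simp
  isCompl_ker := by
    rw [D.ker_fderiv_eq_span hz₀, isCompl_iff]
    constructor
    · rw [Submodule.disjoint_def]
      intro x hx hx'
      rw [Submodule.mem_span_singleton] at hx
      obtain ⟨c, rfl⟩ := hx
      rw [LinearMap.mem_ker, ContinuousLinearMap.coe_coe, ContinuousLinearMap.proj_apply,
        Pi.smul_apply, smul_eq_mul, mul_eq_zero] at hx'
      rcases hx' with h | h
      · rw [h, zero_smul]
      · exact (hj₀ h).elim
    · rw [codisjoint_iff, Submodule.eq_top_iff']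
      intro x
      refine Submodule.mem_sup.2 ⟨(x j₀ / D.v z₀ j₀) • D.v z₀,
        Submodule.mem_span_singleton.2 ⟨_, rfl⟩, x - (x j₀ / D.v z₀ j₀) • D.v z₀, ?_, by abel⟩
      rw [LinearMap.mem_ker, ContinuousLinearMap.coe_coe, ContinuousLinearMap.proj_apply,
        Pi.sub_apply, Pi.smul_apply, smul_eq_mul, div_mul_cancel₀ _ hj₀, sub_self]

/-- A function with nonzero derivative at `0` takes values strictly on both sides of its value at
`0`, at times `t₁ < 0 < t₂` as close to `0` as desired. [folklore] -/
theorem exists_lt_lt_of_hasDerivAt_ne_zero {m : ℝ → ℝ} {m' : ℝ} (hm : HasDerivAt m m' 0)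
    (hm' : m' ≠ 0) {η : ℝ} (hη : 0 < η) :
    ∃ t₁ t₂ : ℝ, -η < t₁ ∧ t₁ < 0 ∧ 0 < t₂ ∧ t₂ < η ∧
      ((m t₁ < m 0 ∧ m 0 < m t₂) ∨ (m t₂ < m 0 ∧ m 0 < m t₁)) := by
  have hslope := hasDerivAt_iff_tendsto_slope.1 hm
  -- eventually the slope has the sign of `m'`
  have hev : ∀ᶠ t in 𝓝[≠] (0 : ℝ), 0 < m' * slope m 0 t := by
    have hpos : 0 < m' * m' := mul_self_pos.2 hm'
    have hcont : Tendsto (fun t => m' * slope m 0 t) (𝓝[≠] 0) (𝓝 (m' * m')) :=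
      hslope.const_mul m'
    exact hcont.eventually (lt_mem_nhds hpos)
  rw [eventually_nhdsWithin_iff, Metric.eventually_nhds_iff] at hev
  obtain ⟨ε, hε, hεP⟩ := hev
  set t₂ : ℝ := min ε η / 2 with ht₂
  have ht₂pos : 0 < t₂ := by rw [ht₂]; exact div_pos (lt_min hε hη) two_pos
  have ht₂ε : t₂ < ε := by
    rw [ht₂]; linarith [min_le_left ε η]
  have ht₂η : t₂ < η := by
    rw [ht₂]; linarith [min_le_right ε η]
  have key : ∀ t : ℝ, t ≠ 0 → |t| < ε → 0 < m' * ((m t - m 0) / t) := by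
    intro t ht hta
    have h := hεP (y := t) (by rwa [dist_zero_right, Real.norm_eq_abs]) ht
    rwa [slope_def_field, sub_zero] at h
  have h2 := key t₂ ht₂pos.ne' (by rwa [abs_of_pos ht₂pos])
  have h1 := key (-t₂) (by linarith) (by rwa [abs_neg, abs_of_pos ht₂pos])
  refine ⟨-t₂, t₂, by linarith, by linarith, ht₂pos, ht₂η, ?_⟩
  have e2 : m' * ((m t₂ - m 0) / t₂) = (m' * (m t₂ - m 0)) / t₂ := by ring
  have e1 : m' * ((m (-t₂) - m 0) / -t₂) = -(m' * (m (-t₂) - m 0)) / t₂ := by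
    field_simp
  rw [e2, div_pos_iff_of_pos_right ht₂pos] at h2
  rw [e1, div_pos_iff_of_pos_right ht₂pos, neg_pos] at h1
  rcases lt_or_gt_of_ne hm' with hneg | hpos
  · right
    constructor
    · nlinarith
    · nlinarith
  · left
    constructor
    · nlinarith
    · nlinarith

/-- **Flow box.** Every point `z₀` of `Γ` has a neighbourhood `U` such that `Γ ∩ U` is contained
in the arc `traj z₀ (-1, 1)` of the trajectory through `z₀` (implicit function theorem: near
`z₀`, `Γ` is a graph over the coordinate `x_{j₀}`, and this coordinate is strictly monotone along
the trajectory through `z₀`, so by the intermediate value theorem every nearby point of `Γ` is a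
trajectory point). [folklore] -/
theorem exists_nhds_curve_inter_subset_traj {z₀ : Fin (d + 1) → ℝ} (hz₀ : z₀ ∈ D.curve) :
    ∃ U ∈ 𝓝 z₀, D.curve ∩ U ⊆ D.traj z₀ '' Ioo (-1) 1 := by
  obtain ⟨j₀, hj₀⟩ := Function.ne_iff.1 (D.v_ne_zero hz₀)
  -- the implicit function `c` with `Γ = {x | c (x j₀) = x}` near `z₀`
  obtain ⟨c, hc1⟩ : ∃ c : ℝ → Fin (d + 1) → ℝ, ∀ᶠ x in 𝓝 z₀, D.H x = 0 ↔ c (x j₀) = x := by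
    refine ⟨fun τ => (D.implicitData hz₀ hj₀).implicitFunction 0 τ, ?_⟩
    have h := (D.implicitData hz₀ hj₀).leftFun_eq_iff_implicitFunction
    have e2 : (D.implicitData hz₀ hj₀).leftFun (D.implicitData hz₀ hj₀).pt = 0 := hz₀
    rw [e2] at h
    exact h
  obtain ⟨U₁, hU₁P, hU₁o, hU₁z⟩ := _root_.eventually_nhds_iff.1 hc1
  have hU₁ : U₁ ∈ 𝓝 z₀ := hU₁o.mem_nhds hU₁z
  -- the trajectory through `z₀` stays in `U₁` for small times
  set γ := D.traj z₀ with hγ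
  have hγU : ∀ᶠ t in 𝓝 (0 : ℝ), γ t ∈ U₁ := by
    have hct : ContinuousAt γ 0 := (D.continuous_traj z₀).continuousAt
    have h0 : U₁ ∈ 𝓝 (γ 0) := by rw [hγ, D.traj_zero]; exact hU₁
    exact hct.preimage_mem_nhds h0
  obtain ⟨η, hη, hηU⟩ := Metric.eventually_nhds_iff.1 hγU
  set η' := min η 1 with hη'
  have hη'pos : 0 < η' := lt_min hη one_pos
  -- the coordinate `j₀` is strictly monotone at `t = 0` along the trajectory
  have hm : HasDerivAt (fun t => γ t j₀) (D.field z₀ j₀) 0 := by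
    have h := (hasDerivAt_pi.1 (D.hasDerivAt_traj z₀ 0)) j₀
    rwa [D.traj_zero] at h
  have hm' : D.field z₀ j₀ ≠ 0 := by
    rw [field, Pi.smul_apply, smul_eq_mul]
    exact mul_ne_zero (D.nf_pos z₀).ne' hj₀
  obtain ⟨t₁, t₂, ht₁, ht₁0, ht₂0, ht₂, hsides⟩ :=
    exists_lt_lt_of_hasDerivAt_ne_zero hm hm' hη'pos
  have hγ0 : γ 0 j₀ = z₀ j₀ := by rw [hγ, D.traj_zero]
  rw [hγ0] at hsides
  -- the neighbourhood
  set a := min (γ t₁ j₀) (γ t₂ j₀) with ha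
  set b := max (γ t₁ j₀) (γ t₂ j₀) with hb
  have hab : z₀ j₀ ∈ Ioo a b := by
    rcases hsides with ⟨h1, h2⟩ | ⟨h1, h2⟩
    · exact ⟨(min_le_left _ _).trans_lt h1, h2.trans_le (le_max_right _ _)⟩
    · exact ⟨(min_le_right _ _).trans_lt h1, h2.trans_le (le_max_left _ _)⟩
  have hU₂ : (fun x : Fin (d + 1) → ℝ => x j₀) ⁻¹' Ioo a b ∈ 𝓝 z₀ :=
    (continuous_apply j₀).continuousAt.preimage_mem_nhds (Ioo_mem_nhds hab.1 hab.2)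
  refine ⟨U₁ ∩ (fun x : Fin (d + 1) → ℝ => x j₀) ⁻¹' Ioo a b, inter_mem hU₁ hU₂, ?_⟩
  rintro x ⟨hxΓ, hxU₁, hxab⟩
  -- a time `t ∈ [t₁, t₂]` with `γ t j₀ = x j₀`
  have hcont : ContinuousOn (fun t => γ t j₀) (uIcc t₁ t₂) :=
    ((continuous_apply j₀).comp (D.continuous_traj z₀)).continuousOn
  have hxmem : x j₀ ∈ uIcc (γ t₁ j₀) (γ t₂ j₀) := by
    rw [uIcc, mem_Icc]
    exact ⟨le_of_lt hxab.1, le_of_lt hxab.2⟩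
  obtain ⟨t, ht, htx⟩ := intermediate_value_uIcc hcont hxmem
  have ht' : t ∈ Icc t₁ t₂ := by rwa [uIcc_of_le (by linarith : t₁ ≤ t₂)] at ht
  have htI : t ∈ Ioo (-1 : ℝ) 1 := by
    constructor
    · linarith [ht'.1, min_le_right η 1]
    · linarith [ht'.2, min_le_right η 1]
  -- `γ t` and `x` are both the point of `Γ` over `x j₀`
  have hγtU : γ t ∈ U₁ := by
    refine hηU ?_
    rw [dist_zero_right, Real.norm_eq_abs, abs_lt]
    constructor <;> linarith [ht'.1, ht'.2, min_le_left η 1]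
  have hγtΓ : D.H (γ t) = 0 := D.traj_mem_curve hz₀ t
  have e1 : c (x j₀) = x := (hU₁P x hxU₁).1 hxΓ
  have e2 : c (γ t j₀) = γ t := (hU₁P (γ t) hγtU).1 hγtΓ
  refine ⟨t, htI, ?_⟩
  have htx' : γ t j₀ = x j₀ := htx
  rw [← e1, ← htx', e2]

/-! ### Injective trajectories are proper -/

/-- If `traj z t = traj x s` then `x = traj z (t - s)`. [folklore] -/
theorem eq_traj_sub_of_traj_eq {z x : Fin (d + 1) → ℝ} {t s : ℝ} (h : D.traj z t = D.traj x s) :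
    x = D.traj z (t - s) := by
  have e : D.traj x 0 = D.traj (D.traj x s) (-s) := by
    rw [← D.traj_add]; simp
  rw [D.traj_zero] at e
  rw [e, ← h, ← D.traj_add, sub_eq_add_neg]

/-- **Properness of injective trajectories.** On an injective trajectory in `Γ`, the set of times
spent in any bounded region is bounded: otherwise a limit point `x⋆ ∈ Γ` of `γ(tₖ)`, `|tₖ| → ∞`,
would by the flow box lie on the trajectory at time distance `< 1` from infinitely many `tₖ`,
contradicting injectivity. [folklore] -/
theorem exists_abs_le_of_injective {z : Fin (d + 1) → ℝ} (hz : z ∈ D.curve)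
    (hinj : Injective (D.traj z)) (R : ℝ) :
    ∃ T : ℝ, ∀ t, ‖D.traj z t‖ ≤ R → |t| ≤ T := by
  by_contra hcon
  push Not at hcon
  choose t ht using hcon
  -- `t T` has `‖traj z (t T)‖ ≤ R` and `|t T| > T`; use `T = n : ℕ`
  have hmem : ∀ n : ℕ, D.traj z (t n) ∈ closedBall (0 : Fin (d + 1) → ℝ) R := fun n => by
    rw [mem_closedBall, dist_zero_right]; exact (ht n).1
  obtain ⟨xs, -, φ, hφ, hlim⟩ :=
    (isCompact_closedBall (0 : Fin (d + 1) → ℝ) R).tendsto_subseq hmem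
  have hxs : xs ∈ D.curve :=
    D.isClosed_curve.mem_of_tendsto hlim (Eventually.of_forall fun n => D.traj_mem_curve hz _)
  obtain ⟨U, hU, hUsub⟩ := D.exists_nhds_curve_inter_subset_traj hxs
  have hev : ∀ᶠ n in atTop, D.traj z (t (φ n)) ∈ U := hlim hU
  obtain ⟨N, hN⟩ := eventually_atTop.1 hev
  -- for `n ≥ N`: `xs = traj z (t (φ n) - s)` with `|s| < 1`
  have hpt : ∀ n, N ≤ n → ∃ s : ℝ, |s| < 1 ∧ xs = D.traj z (t (φ n) - s) := by
    intro n hn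
    obtain ⟨s, hs, hse⟩ := hUsub ⟨D.traj_mem_curve hz _, hN n hn⟩
    exact ⟨s, abs_lt.2 ⟨by linarith [hs.1], hs.2⟩, D.eq_traj_sub_of_traj_eq hse.symm⟩
  obtain ⟨s₀, hs₀, he₀⟩ := hpt N le_rfl
  -- choose `n ≥ N` with `n > |t (φ N)| + 2`
  obtain ⟨n, hnN, hn⟩ : ∃ n : ℕ, N ≤ n ∧ |t (φ N)| + 2 < n := by
    obtain ⟨k, hk⟩ := exists_nat_gt (|t (φ N)| + 2)
    refine ⟨max N k, le_max_left _ _, hk.trans_le ?_⟩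
    exact_mod_cast le_max_right N k
  obtain ⟨s₁, hs₁, he₁⟩ := hpt n hnN
  have heq : t (φ N) - s₀ = t (φ n) - s₁ := hinj (he₀.symm.trans he₁)
  have hbig : (n : ℝ) < |t (φ n)| := by
    have h1 := (ht (φ n)).2
    have h2 : (n : ℝ) ≤ (φ n : ℕ) := by exact_mod_cast hφ.le_apply
    linarith
  have hle : |t (φ n)| ≤ |t (φ N)| + |s₀| + |s₁| := by
    have e : t (φ n) = t (φ N) - s₀ + s₁ := by linarith
    rw [e]
    calc |t (φ N) - s₀ + s₁| ≤ |t (φ N) - s₀| + |s₁| := abs_add_le _ _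
      _ ≤ |t (φ N)| + |s₀| + |s₁| := by gcongr; exact abs_sub _ _
  linarith

/-- On an injective trajectory in `Γ`, `‖γ(t)‖ → ∞` as `t → +∞`. [folklore] -/
theorem tendsto_norm_traj_atTop {z : Fin (d + 1) → ℝ} (hz : z ∈ D.curve)
    (hinj : Injective (D.traj z)) : Tendsto (fun t => ‖D.traj z t‖) atTop atTop := by
  refine tendsto_atTop.2 fun R => ?_
  obtain ⟨T, hT⟩ := D.exists_abs_le_of_injective hz hinj R
  filter_upwards [eventually_gt_atTop (max T 0 + 1)] with t ht
  by_contra hlt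
  push Not at hlt
  have h1 := hT t hlt.le
  have h2 : t ≤ |t| := le_abs_self t
  linarith [le_max_left T 0]

/-- On an injective trajectory in `Γ`, `‖γ(t)‖ → ∞` as `t → -∞`. [folklore] -/
theorem tendsto_norm_traj_atBot {z : Fin (d + 1) → ℝ} (hz : z ∈ D.curve)
    (hinj : Injective (D.traj z)) : Tendsto (fun t => ‖D.traj z t‖) atBot atTop := by
  refine tendsto_atTop.2 fun R => ?_
  obtain ⟨T, hT⟩ := D.exists_abs_le_of_injective hz hinj R
  filter_upwards [eventually_lt_atBot (-(max T 0) - 1)] with t ht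
  by_contra hlt
  push Not at hlt
  have h1 := hT t hlt.le
  have h2 : -t ≤ |t| := neg_le_abs t
  linarith [le_max_left T 0]

end LevelCurveData

end Literature.Analysis.ODE
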